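import Mathlib.RingTheory.MvPolynomial.Homogeneous
import Mathlib.RingTheory.Polynomial.Basic
import Mathlib.Algebra.MvPolynomial.Nilpotent
import Mathlib.FieldTheory.IsAlgClosed.Basic
import Mathlib.Algebra.MvPolynomial.PDeriv
import HarnessLib

/-!
# Quadratic forms in at most two variables are reducible; `rename` reflects irreducibility

Topic `Literature/AlgebraicGeometry/Motives`; THEOREMS ONLY (no definition, no instance, no named fact).  Elementary
algebra used by the characteristic-free normal form of PRIME quadratic forms (companion `Motives/QuadraticFormSingularRadical`):
a prime quadratic form has regular part in at least three variables, because

* `not_isUnit_of_coeff_single_ne_zero`, `isUnit_of_isUnit_rename`, `irreducible_of_irreducible_rename` — units of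
  `k[x]` are the non-zero constants, so `rename` along an injective map of variables reflects units and irreducibility
  (Fulton, *Algebraic Curves*, §1.1);
* `eq_zero_of_isHomogeneous_two_fin_zero`, `eq_C_mul_X_sq_of_isHomogeneous_two_fin_one`, `eq_of_isHomogeneous_two_fin_two`
  — a quadratic form in `0 / 1 / 2` variables is `0 / α x₀² / α x₀² + β x₀x₁ + γ x₁²`;
* `not_irreducible_of_isHomogeneous_two_fin_one`, ★ `not_irreducible_of_isHomogeneous_two_fin_two` — such forms are
  reducible, the binary case over an ALGEBRAICALLY CLOSED field (Fulton §2.6, Corollary: a binary form over an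
  algebraically closed field is a product of linear forms; in degree `2` one root `t` of `γT² + βT + α` gives
  `γx₁² + βx₀x₁ + αx₀² = (x₁ − tx₀)(γx₁ + (β + γt)x₀)`, no `2⁻¹` needed).

What is NOT here: higher degree binary forms; irreducibility of forms of rank `≥ 3` (Mathlib
`MvPolynomial.irreducible_sumSMulXSMulY` covers `Σ cᵢ XᵢYᵢ`).

## References

* W. Fulton, *Algebraic Curves* (3rd ed., 2008), §1.1 (polynomial rings: units, unique factorisation), §2.6 (forms;
  Corollary on binary forms over an algebraically closed field). [Fulton2008]

## Provenance

Cell `pub/decomp-res` (summit `ResolutionOfSingularities`, route `EquisingularLift`), seat `leafhand-res-equisingularlift-6` g3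
(prover), 2026-08-31.  AI-produced, weaker than expert review.
-/

noncomputable section

universe u

namespace Literature.AlgebraicGeometry.Motives

namespace ProjectiveSpaceCells

open _root_.MvPolynomial

variable {k : Type u} [Field k]

/-! ### Units and `rename` -/

/-- A polynomial over a field with a non-zero coefficient at some variable `xᵢ` is not a unit (units of `k[x]` are the
non-zero constants, Fulton §1.1). [cite: Fulton2008, §1.1 (units of polynomial rings)] -/
theorem not_isUnit_of_coeff_single_ne_zero {σ : Type*} {P : MvPolynomial σ k} (i : σ)
    (h : coeff (Finsupp.single i 1) P ≠ 0) : ¬IsUnit P := by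
  classical
  intro hP
  obtain ⟨r, -, rfl⟩ := isUnit_iff_eq_C_of_isReduced.mp hP
  rw [coeff_C, if_neg (Finsupp.single_ne_zero.mpr one_ne_zero).symm] at h
  exact h rfl

/-- `rename` along an injective map of variables reflects units (units of `k[x]` are the non-zero constants).
[cite: Fulton2008, §1.1 (units of polynomial rings)] -/
theorem isUnit_of_isUnit_rename {σ τ : Type*} {f : σ → τ} (hf : Function.Injective f)
    {A : MvPolynomial σ k} (hA : IsUnit (rename f A)) : IsUnit A := by
  obtain ⟨r, hr, hA'⟩ := isUnit_iff_eq_C_of_isReduced.mp hA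
  have : A = C r := rename_injective f hf (by rw [hA', rename_C])
  rw [this]
  exact hr.map C

/-- `rename` along an injective map of variables reflects irreducibility: a factorisation of `G` renames to a
factorisation of `rename f G`. [cite: Fulton2008, §1.1 (unique factorisation in `k[x₁, …, x_n]`)] -/
theorem irreducible_of_irreducible_rename {σ τ : Type*} {f : σ → τ} (hf : Function.Injective f)
    {G : MvPolynomial σ k} (h : Irreducible (rename f G)) : Irreducible G := by
  refine irreducible_iff.mpr ⟨fun hu => h.not_isUnit (hu.map (rename f)), fun A B hAB => ?_⟩
  rcases h.isUnit_or_isUnit (show rename f G = rename f A * rename f B by rw [hAB, map_mul]) with hA | hB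
  · exact Or.inl (isUnit_of_isUnit_rename hf hA)
  · exact Or.inr (isUnit_of_isUnit_rename hf hB)

/-- A quadratic form in no variables is zero (its only exponent vector is `0`, of degree `0 ≠ 2`).
[cite: Fulton2008, §2.6 (forms)] -/
theorem eq_zero_of_isHomogeneous_two_fin_zero {G : MvPolynomial (Fin 0) k} (hG : G.IsHomogeneous 2) : G = 0 := by
  ext d
  rw [coeff_zero]
  refine hG.coeff_eq_zero fun hd => ?_
  have : d = 0 := Subsingleton.elim _ _
  rw [this, map_zero] at hd
  exact absurd hd (by norm_num)

/-- A quadratic form in one variable is `α x₀²`. [cite: Fulton2008, §2.6 (forms)] -/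
theorem eq_C_mul_X_sq_of_isHomogeneous_two_fin_one {G : MvPolynomial (Fin 1) k} (hG : G.IsHomogeneous 2) :
    G = C (coeff (Finsupp.single 0 2) G) * X 0 ^ 2 := by
  classical
  ext d
  have hd : d = Finsupp.single 0 (d 0) := by
    refine Finsupp.ext fun i => ?_
    fin_cases i
    simp
  rw [coeff_C_mul, X_pow_eq_monomial, coeff_monomial]
  by_cases h2 : d 0 = 2
  · rw [h2] at hd
    rw [if_pos hd.symm, hd, mul_one]
  · rw [if_neg (fun h => h2 (by rw [← h]; simp)), mul_zero]
    refine hG.coeff_eq_zero fun hdeg => h2 ?_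
    rw [hd, Finsupp.degree_single] at hdeg
    exact hdeg

/-- **Quadratic forms in one variable are reducible**: `α x₀² = (α x₀) · x₀` (or `0`). [cite: Fulton2008, §2.6 (forms; Corollary: factorisation of forms in two variables)] -/
theorem not_irreducible_of_isHomogeneous_two_fin_one {G : MvPolynomial (Fin 1) k} (hG : G.IsHomogeneous 2) :
    ¬Irreducible G := by
  classical
  intro hirr
  have hGeq := eq_C_mul_X_sq_of_isHomogeneous_two_fin_one hG
  set α := coeff (Finsupp.single 0 2) G with hα'
  by_cases hα : α = 0
  · rw [hα, map_zero, zero_mul] at hGeq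
    exact hirr.ne_zero hGeq
  · rcases hirr.isUnit_or_isUnit (show G = (C α * X 0) * X 0 by rw [hGeq]; ring) with h | h
    · exact not_isUnit_of_coeff_single_ne_zero 0 (by simpa using hα) h
    · exact not_isUnit_of_coeff_single_ne_zero (P := (X 0 : MvPolynomial (Fin 1) k)) 0 (by simp) h

/-- A quadratic form in two variables is `α x₀² + β x₀x₁ + γ x₁²` (its exponent vectors are `2e₀, e₀ + e₁, 2e₁`).
[cite: Fulton2008, §2.6 (forms)] -/
theorem eq_of_isHomogeneous_two_fin_two {G : MvPolynomial (Fin 2) k} (hG : G.IsHomogeneous 2) :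
    G = C (coeff (Finsupp.single 0 2) G) * X 0 ^ 2 +
      C (coeff (Finsupp.single 0 1 + Finsupp.single 1 1) G) * X 0 * X 1 +
        C (coeff (Finsupp.single 1 2) G) * X 1 ^ 2 := by
  classical
  set m₁ : Fin 2 →₀ ℕ := Finsupp.single 0 2
  set m₂ : Fin 2 →₀ ℕ := Finsupp.single 0 1 + Finsupp.single 1 1
  set m₃ : Fin 2 →₀ ℕ := Finsupp.single 1 2
  have h12 : m₁ ≠ m₂ := fun h => by simpa [m₁, m₂] using DFunLike.congr_fun h 0
  have h13 : m₁ ≠ m₃ := fun h => by simpa [m₁, m₃] using DFunLike.congr_fun h 0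
  have h23 : m₂ ≠ m₃ := fun h => by simpa [m₂, m₃] using DFunLike.congr_fun h 0
  have hsupp : G.support ⊆ {m₁, m₂, m₃} := by
    intro d hd
    have hdeg : d.degree = 2 := by
      rw [Finsupp.degree_eq_weight_one]
      exact hG (mem_support_iff.mp hd)
    have hd' : d = Finsupp.single 0 (d 0) + Finsupp.single 1 (d 1) := by
      refine Finsupp.ext fun i => ?_
      fin_cases i <;> simp
    rw [hd', map_add, Finsupp.degree_single, Finsupp.degree_single] at hdeg
    simp only [Finset.mem_insert, Finset.mem_singleton]
    rcases Nat.le.dest (show d 0 ≤ 2 by omega) with ⟨r, hr⟩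
    have h0 : d 0 = 0 ∨ d 0 = 1 ∨ d 0 = 2 := by omega
    rcases h0 with h0 | h0 | h0
    · right; right
      rw [hd', h0, show d 1 = 2 by omega, Finsupp.single_zero, zero_add]
    · right; left
      rw [hd', h0, show d 1 = 1 by omega]
    · left
      rw [hd', h0, show d 1 = 0 by omega, Finsupp.single_zero, add_zero]
  conv_lhs => rw [G.as_sum, Finset.sum_subset hsupp (fun d _ hd => by
    rw [notMem_support_iff.mp hd, map_zero])]
  rw [Finset.sum_insert (by simp [h12, h13]), Finset.sum_insert (by simp [h23]), Finset.sum_singleton]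
  have e1 : ∀ b : k, C b * X 0 ^ 2 = monomial m₁ b := fun b => by
    rw [X_pow_eq_monomial, C_mul_monomial, mul_one]
  have e2 : ∀ b : k, C b * X 0 * X 1 = monomial m₂ b := fun b => by
    rw [X, X, C_mul_monomial, monomial_mul, mul_one, mul_one]
  have e3 : ∀ b : k, C b * X 1 ^ 2 = monomial m₃ b := fun b => by
    rw [X_pow_eq_monomial, C_mul_monomial, mul_one]
  rw [e1, e2, e3, add_assoc]

/-- **Binary quadratic forms over an algebraically closed field are reducible** — Fulton §2.6, Corollary: «if `k` is
algebraically closed, any form `F ∈ k[X, Y]` factors into a product of linear forms»; here in degree `2` explicitly: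
`γ = 0`: `x₀ (α x₀ + β x₁)`; `γ ≠ 0`: `(x₁ − t x₀)(γ x₁ + (β + γ t) x₀)` for a root `t` of `γ T² + β T + α`.
[cite: Fulton2008, §2.6 Corollary (factorisation of binary forms over an algebraically closed field)] -/
theorem not_irreducible_of_isHomogeneous_two_fin_two [IsAlgClosed k] {G : MvPolynomial (Fin 2) k}
    (hG : G.IsHomogeneous 2) : ¬Irreducible G := by
  classical
  intro hirr
  have hGeq := eq_of_isHomogeneous_two_fin_two hG
  set α := coeff (Finsupp.single 0 2) G
  set β := coeff (Finsupp.single 0 1 + Finsupp.single 1 1) G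
  set γ := coeff (Finsupp.single 1 2) G
  have hX0 : ¬IsUnit (X 0 : MvPolynomial (Fin 2) k) := not_isUnit_of_coeff_single_ne_zero 0 (by simp)
  by_cases hγ : γ = 0
  · rw [hγ, map_zero, zero_mul, add_zero] at hGeq
    by_cases hαβ : α = 0 ∧ β = 0
    · rw [hαβ.1, hαβ.2, map_zero, zero_mul, zero_mul, zero_mul, add_zero] at hGeq
      exact hirr.ne_zero hGeq
    · have hL : ¬IsUnit (C α * X 0 + C β * X 1 : MvPolynomial (Fin 2) k) := by
        by_cases hα : α = 0
        · have hβ : β ≠ 0 := fun hβ => hαβ ⟨hα, hβ⟩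
          exact not_isUnit_of_coeff_single_ne_zero 1 (by simpa [hα] using hβ)
        · refine not_isUnit_of_coeff_single_ne_zero 0 ?_
          simp only [coeff_add, coeff_C_mul, coeff_X, if_true]
          rw [if_neg (fun h => by simpa using DFunLike.congr_fun h 1)]
          simpa using hα
      rcases hirr.isUnit_or_isUnit (show G = X 0 * (C α * X 0 + C β * X 1) by rw [hGeq]; ring) with h | h
      · exact hX0 h
      · exact hL h
  · -- a root `t` of `γ T² + β T + α`
    obtain ⟨t, ht⟩ := IsAlgClosed.exists_root
      (Polynomial.C γ * Polynomial.X ^ 2 + Polynomial.C β * Polynomial.X + Polynomial.C α)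
      (by rw [Polynomial.degree_quadratic hγ]; norm_num)
    have ht' : γ * t ^ 2 + β * t + α = 0 := by
      simpa [Polynomial.IsRoot] using ht
    have hC : C γ * C t ^ 2 + C β * C t + C α = (0 : MvPolynomial (Fin 2) k) := by
      have h := congrArg (C : k → MvPolynomial (Fin 2) k) ht'
      simpa only [map_add, map_mul, map_pow, map_zero] using h
    have hfac : G = (X 1 - C t * X 0) * (C γ * X 1 + (C β + C γ * C t) * X 0) := by
      rw [hGeq]
      linear_combination (X 0 ^ 2) * hC
    have hL₁ : ¬IsUnit (X 1 - C t * X 0 : MvPolynomial (Fin 2) k) := by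
      refine not_isUnit_of_coeff_single_ne_zero 1 ?_
      simp only [coeff_sub, coeff_C_mul, coeff_X, if_true]
      rw [if_neg (fun h => by simpa using DFunLike.congr_fun h 0)]
      simp
    have hL₂ : ¬IsUnit (C γ * X 1 + (C β + C γ * C t) * X 0 : MvPolynomial (Fin 2) k) := by
      refine not_isUnit_of_coeff_single_ne_zero 1 ?_
      rw [← map_mul, ← map_add]
      simp only [coeff_add, coeff_C_mul, coeff_X, if_true]
      rw [if_neg (fun h => by simpa using DFunLike.congr_fun h 0)]
      simpa using hγ
    rcases hirr.isUnit_or_isUnit hfac with h | h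
    · exact hL₁ h
    · exact hL₂ h

end ProjectiveSpaceCells

end Literature.AlgebraicGeometry.Motives

end
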